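import Summits.MatrixMultiplication.MatrixMultiplication.Theorems.AbelianSTPPCensusShapeCertVQDefsE
import Summits.MatrixMultiplication.MatrixMultiplication.Theorems.AbelianSTPPCensusShapeCertVQSearch
import Literature.Computability.AlgebraicComplexity.CircuitGateSemantics

/-!
# Abelian STPP census — soundness of `ShapeCertVQ.checkQE`, part 1: the E3⁺ continuation budget is sound; node bounds with a budget

Cell mm-stpp, rung F-M1; successor kernel item VQ-CERT (T_E beyond 337 under vQ := vP ∧ E3⁺) in support of the closed crux item
stmt-MatrixMultiplication-19191; seat mm-stpp-vp-p2 (gen 1).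
* **`AboveQ.tail_uu_le_qE`** — for a vQ-admissible family `G` above a prefix `fam`, the tail's packing mass `Σ_{G ∖ fam}(ab+bc+ca)` is at
  most `qEOf M (aggOf M fam) fam q` whenever it is at most `q`.  Per member `t = (x,y,z)` of the prefix (`qEOfT`, arithmetic core
  `budget_core`): rule U14 (`AboveQ.tail_pbc/pca/pab` with the member's own offsets `V − bc`, …) bounds the tail's three letter sums by
  the E3⁺ slacks `s_X = M − V − S_X`, so the family's slacks are `s_X − U_X ≥ 0` and stay in the exact regime of
  `STPPThreeRoomEnergy.e3pL` (eng-2 g5's `e3pL_eq_of_le`), where lowering the slacks by `(U_A,U_B,U_C)` raises `e3pL` by at least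
  `(M + 1 − maxpair)·(U_A+U_B+U_C)` (`e3pL_drop`); the E3⁺ condition of `G` at that member (`AdmE`) caps it at `V²`.
* `AboveQ.not_beat_of_Rq`, `AboveQ.not_beat_of_first_q` — the packing-ratio and first-member bounds of `…ShapeCertVQBounds` with an
  arbitrary tail budget `q` in place of eng-2's `q0`.
Part 2 (`…ShapeCertVQSearchE`): the search induction, `checkQE_sound`, root segments.
-/

set_option linter.dupNamespace false -- `MatrixMultiplication.MatrixMultiplication` (summit = problem, D-0017)
set_option autoImplicit false

namespace Summit.MatrixMultiplication.MatrixMultiplication.Theorems.ShapeCertVQ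

open ShapeCert ShapeCertVP STPPThreeRoomEnergy Multiset

section budgetE
/-! ### The E3⁺ continuation budget is sound -/

variable {M : ℕ} {G : Multiset (ℕ × ℕ × ℕ)} {fam : List Sh}

/-- the affine identity of `e3pL` in the exact regime: lowering the slacks `(r + U)` to `r` (all inside `V`) raises `e3pL` by
`M·U − U − ((x−1)(U_B+U_C) + (y−1)(U_A+U_C) + (z−1)(U_A+U_B))` -/
theorem e3pL_drop {M V x y z rA rB rC UA UB UC : ℕ} (hV : rA + UA + (rB + UB) + (rC + UC) ≤ V) :
    e3pL M V x y z rA rB rC + (UA + UB + UC) + ((x - 1) * (UB + UC) + (y - 1) * (UA + UC) + (z - 1) * (UA + UB)) =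
      e3pL M V x y z (rA + UA) (rB + UB) (rC + UC) + M * (UA + UB + UC) := by
  have h1 : rA + rB + rC ≤ V := by omega
  rw [e3pL_eq_of_le h1, e3pL_eq_of_le hV]
  obtain ⟨θ, hθ⟩ : ∃ θ, V = θ + (rA + UA + (rB + UB) + (rC + UC)) :=
    ⟨V - (rA + UA + (rB + UB) + (rC + UC)), by omega⟩
  have e1 : V - (rA + rB + rC) = θ + (UA + UB + UC) := by omega
  have e2 : V - (rA + UA + (rB + UB) + (rC + UC)) = θ := by omega
  rw [e1, e2]
  ring

/-- the arithmetic core of the budget: in the exact regime, tail letter masses `U_X ≤ s_X` that keep `e3pL ≤ V²` have total mass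
`≤ (V² − e3pL(s)) / (M + 1 − mp)` where `mp − 2` dominates the three sums of two decremented sides -/
theorem budget_core {M V x y z sA sB sC UA UB UC mp : ℕ}
    (hσ : sA + sB + sC ≤ V) (uA : UA ≤ sA) (uB : UB ≤ sB) (uC : UC ≤ sC)
    (hmA : (y - 1) + (z - 1) ≤ mp - 2) (hmB : (x - 1) + (z - 1) ≤ mp - 2) (hmC : (x - 1) + (y - 1) ≤ mp - 2)
    (hmp2 : 2 ≤ mp) (hc : 0 < M + 1 - mp)
    (hadm : e3pL M V x y z (sA - UA) (sB - UB) (sC - UC) ≤ V * V) :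
    (M + 1 - mp) * (UA + UB + UC) ≤ V * V - e3pL M V x y z sA sB sC := by
  obtain ⟨rA, rfl⟩ : ∃ rA, sA = rA + UA := ⟨sA - UA, by omega⟩
  obtain ⟨rB, rfl⟩ : ∃ rB, sB = rB + UB := ⟨sB - UB, by omega⟩
  obtain ⟨rC, rfl⟩ : ∃ rC, sC = rC + UC := ⟨sC - UC, by omega⟩
  rw [Nat.add_sub_cancel, Nat.add_sub_cancel, Nat.add_sub_cancel] at hadm
  have hid := e3pL_drop (M := M) (x := x) (y := y) (z := z) (rA := rA) (rB := rB) (rC := rC) (UA := UA) (UB := UB) (UC := UC)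
    (by omega)
  have e : (x - 1) * (UB + UC) + (y - 1) * (UA + UC) + (z - 1) * (UA + UB) =
      (y - 1 + (z - 1)) * UA + (x - 1 + (z - 1)) * UB + (x - 1 + (y - 1)) * UC := by ring
  have i1 := Nat.mul_le_mul_right UA hmA
  have i2 := Nat.mul_le_mul_right UB hmB
  have i3 := Nat.mul_le_mul_right UC hmC
  have e2 : (mp - 2) * UA + (mp - 2) * UB + (mp - 2) * UC = (mp - 2) * (UA + UB + UC) := by ring
  have e3 : (M + 1 - mp) * (UA + UB + UC) + (UA + UB + UC) + (mp - 2) * (UA + UB + UC) = M * (UA + UB + UC) := by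
    have hM : (M + 1 - mp) + 1 + (mp - 2) = M := by omega
    calc (M + 1 - mp) * (UA + UB + UC) + (UA + UB + UC) + (mp - 2) * (UA + UB + UC)
        = ((M + 1 - mp) + 1 + (mp - 2)) * (UA + UB + UC) := by ring
      _ = M * (UA + UB + UC) := by rw [hM]
  rw [e] at hid
  omega

/-- what a defined member budget says (the conditions of `qEOfT` and its value) -/
theorem qEOfT_spec {M : ℕ} {A : Agg} {t : Sh} {b : ℕ} (hb : qEOfT M A t = some b) :
    M < 2 * t.V ∧ t.V + (A.sbc - t.bc) ≤ M ∧ t.V + (A.sca - t.ca) ≤ M ∧ t.V + (A.sab - t.ab) ≤ M ∧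
    (M - t.V - (A.sbc - t.bc)) + (M - t.V - (A.sca - t.ca)) + (M - t.V - (A.sab - t.ab)) ≤ t.V ∧
    e3pL M t.V t.a t.b t.c (M - t.V - (A.sbc - t.bc)) (M - t.V - (A.sca - t.ca)) (M - t.V - (A.sab - t.ab)) ≤ t.V * t.V ∧
    0 < M + 1 - mpS t ∧
    b = (t.V * t.V - e3pL M t.V t.a t.b t.c (M - t.V - (A.sbc - t.bc)) (M - t.V - (A.sca - t.ca)) (M - t.V - (A.sab - t.ab)))
      / (M + 1 - mpS t) := by
  unfold qEOfT at hb
  simp only [seqN_eq] at hb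
  split_ifs at hb with c1 c2 c3
  rw [Option.some.injEq] at hb
  exact ⟨c1.1, c1.2.1, c1.2.2.1, c1.2.2.2, c2, c3.1, c3.2, hb.symm⟩

/-- **the E3⁺ continuation budget of one prefix member is sound**: the tail packing mass of every vQ-admissible family above the
prefix is at most `qEOfT` of any prefix member for which it is defined -/
theorem AboveQ.tail_uu_le_qEOfT (h : AboveQ M G fam) {t : Sh} (ht : t ∈ fam) {b : ℕ}
    (hb : qEOfT M (aggOf M fam) t = some b) : ((G - famT fam).map uu).sum ≤ b := by
  obtain ⟨h2V, hA, hB, hC, hσ, hf, hc, rfl⟩ := qEOfT_spec hb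
  have wt := h.wf t ht
  have hxF : t.tr ∈ famT fam := tr_mem_famT ht
  have hxG : t.tr ∈ G := h.mem_G ht
  have ea := congrArg Sh.a wt; have eb := congrArg Sh.b wt; have ec := congrArg Sh.c wt; have ev := congrArg Sh.V wt
  have eab := congrArg Sh.ab wt; have ebc := congrArg Sh.bc wt; have eca := congrArg Sh.ca wt
  have edbc := congrArg Sh.dbc wt; have edca := congrArg Sh.dca wt; have edab := congrArg Sh.dab wt
  rw [shQ_a] at ea; rw [shQ_b] at eb; rw [shQ_c] at ec; rw [shQ_V] at ev
  rw [shQ_ab] at eab; rw [shQ_bc] at ebc; rw [shQ_ca] at eca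
  rw [shQ_dbc] at edbc; rw [shQ_dca] at edca; rw [shQ_dab] at edab
  -- the prefix's off-member sums at `t`
  have fbc : sbc fam = t.bc + ((aggOf M fam).sbc - t.bc) := by
    have hle : pbc t.tr ≤ ((famT fam).map pbc).sum := Multiset.le_sum_of_mem (Multiset.mem_map_of_mem pbc hxF)
    show sbc fam = t.bc + (sbc fam - t.bc); rw [sbc_eqQ h.wf, ebc]; omega
  have fca : sca fam = t.ca + ((aggOf M fam).sca - t.ca) := by
    have hle : pca t.tr ≤ ((famT fam).map pca).sum := Multiset.le_sum_of_mem (Multiset.mem_map_of_mem pca hxF)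
    show sca fam = t.ca + (sca fam - t.ca); rw [sca_eqQ h.wf, eca]; omega
  have fab : sab fam = t.ab + ((aggOf M fam).sab - t.ab) := by
    have hle : pab t.tr ≤ ((famT fam).map pab).sum := Multiset.le_sum_of_mem (Multiset.mem_map_of_mem pab hxF)
    show sab fam = t.ab + (sab fam - t.ab); rw [sab_eqQ h.wf, eab]; omega
  have gA' : sbc fam - t.bc = (((famT fam).erase t.tr).map pbc).sum := by rw [sbc_eqQ h.wf, ebc]; exact erase_sum_eq hxF pbc
  have gB' : sca fam - t.ca = (((famT fam).erase t.tr).map pca).sum := by rw [sca_eqQ h.wf, eca]; exact erase_sum_eq hxF pca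
  have gC' : sab fam - t.ab = (((famT fam).erase t.tr).map pab).sum := by rw [sab_eqQ h.wf, eab]; exact erase_sum_eq hxF pab
  -- abbreviations
  generalize hSA : (aggOf M fam).sbc - t.bc = SA at hA hσ hf fbc
  generalize hSB : (aggOf M fam).sca - t.ca = SB at hB hσ hf fca
  generalize hSC : (aggOf M fam).sab - t.ab = SC at hC hσ hf fab
  have eSA : (((famT fam).erase t.tr).map pbc).sum = SA := by rw [← gA', ← hSA]; rfl
  have eSB : (((famT fam).erase t.tr).map pca).sum = SB := by rw [← gB', ← hSB]; rfl
  have eSC : (((famT fam).erase t.tr).map pab).sum = SC := by rw [← gC', ← hSC]; rfl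
  -- the tail's letter sums are at most the slacks (rule U14 with the member's own offsets)
  have tA := h.tail_pbc; have tB := h.tail_pca; have tC := h.tail_pab
  have dB : t.dbc ≤ dBC fam := Literature.Computability.AlgebraicComplexity.ArithCircuit.le_foldr_max_of_mem (List.mem_map.mpr ⟨t, ht, rfl⟩)
  have dC : t.dca ≤ dCA fam := Literature.Computability.AlgebraicComplexity.ArithCircuit.le_foldr_max_of_mem (List.mem_map.mpr ⟨t, ht, rfl⟩)
  have dA : t.dab ≤ dAB fam := Literature.Computability.AlgebraicComplexity.ArithCircuit.le_foldr_max_of_mem (List.mem_map.mpr ⟨t, ht, rfl⟩)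
  have hdbc : vol t.tr - pbc t.tr ≤ t.dbc := by rw [edbc]; exact Nat.le_add_right _ _
  have hdca : vol t.tr - pca t.tr ≤ t.dca := by rw [edca]; exact Nat.le_add_right _ _
  have hdab : vol t.tr - pab t.tr ≤ t.dab := by rw [edab]; exact Nat.le_add_right _ _
  have pbcV : pbc t.tr ≤ vol t.tr := (h.univ _ hxG).pbc_le_vol
  have pcaV : pca t.tr ≤ vol t.tr := (h.univ _ hxG).pca_le_vol
  have pabV : pab t.tr ≤ vol t.tr := (h.univ _ hxG).pab_le_vol
  have uA : ((G - famT fam).map pbc).sum ≤ M - t.V - SA := by rw [ev]; omega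
  have uB : ((G - famT fam).map pca).sum ≤ M - t.V - SB := by rw [ev]; omega
  have uC : ((G - famT fam).map pab).sum ≤ M - t.V - SC := by rw [ev]; omega
  -- the family's off-member sums at `t` and its E3⁺ condition there
  have gA : ((G.erase t.tr).map pbc).sum = SA + ((G - famT fam).map pbc).sum := by
    have := h.erase_split ht pbc; rw [← sbc_eqQ h.wf, fbc, ebc] at this; omega
  have gB : ((G.erase t.tr).map pca).sum = SB + ((G - famT fam).map pca).sum := by
    have := h.erase_split ht pca; rw [← sca_eqQ h.wf, fca, eca] at this; omega
  have gC : ((G.erase t.tr).map pab).sum = SC + ((G - famT fam).map pab).sum := by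
    have := h.erase_split ht pab; rw [← sab_eqQ h.wf, fab, eab] at this; omega
  have hadm := h.admE t.tr hxG (by rw [← ev]; exact h2V)
  rw [gA, gB, gC] at hadm
  generalize hUA : ((G - famT fam).map pbc).sum = UA at uA hadm
  generalize hUB : ((G - famT fam).map pca).sum = UB at uB hadm
  generalize hUC : ((G - famT fam).map pab).sum = UC at uC hadm
  -- the family's `e3pLHS` in slack variables
  have hLHS : e3pLHS M t.tr.1 t.tr.2.1 t.tr.2.2 (SA + UA) (SB + UB) (SC + UC) =
      e3pL M t.V t.a t.b t.c (M - t.V - SA - UA) (M - t.V - SB - UB) (M - t.V - SC - UC) := by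
    unfold e3pLHS
    have e0 : t.tr.1 * t.tr.2.1 * t.tr.2.2 = t.V := by rw [ev]; rfl
    rw [e0, ea, eb, ec]
    have q1 : M - (t.V + (SA + UA)) = M - t.V - SA - UA := by omega
    have q2 : M - (t.V + (SB + UB)) = M - t.V - SB - UB := by omega
    have q3 : M - (t.V + (SC + UC)) = M - t.V - SC - UC := by omega
    rw [q1, q2, q3]
  rw [hLHS, sq, ev] at hadm
  obtain ⟨p1, p2, p3, -⟩ := InUniv.sides_vol (h.univ _ hxG)
  have core := budget_core (M := M) (V := t.V) (x := t.a) (y := t.b) (z := t.c) (mp := mpS t) hσ uA uB uC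
    (by unfold mpS; rw [ea, eb, ec]; omega) (by unfold mpS; rw [ea, eb, ec]; omega) (by unfold mpS; rw [ea, eb, ec]; omega)
    (by unfold mpS; rw [ea, eb, ec]; omega) hc (by rw [ev]; exact hadm)
  rw [Nat.le_div_iff_mul_le hc, sum_uu_eq, hUA, hUB, hUC]
  have e : UC + UA + UB = UA + UB + UC := by ring
  rw [e, Nat.mul_comm]
  exact core

/-- **the E3⁺ continuation budget of a prefix is sound**: if the tail mass is at most `q` it is at most `qEOf … q` -/
theorem AboveQ.tail_uu_le_qE (h : AboveQ M G fam) {q : ℕ} (hq : ((G - famT fam).map uu).sum ≤ q) :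
    ((G - famT fam).map uu).sum ≤ qEOf M (aggOf M fam) fam q := by
  unfold qEOf
  suffices H : ∀ l : List Sh, (∀ t ∈ l, t ∈ fam) →
      ((G - famT fam).map uu).sum ≤ l.foldr (fun t acc => match qEOfT M (aggOf M fam) t with | none => acc | some b => min acc b) q
    from H fam (fun t ht => ht)
  intro l hl
  induction l with
  | nil => simpa using hq
  | cons t l ih =>
    rw [List.foldr_cons]
    have ih' := ih (fun s hs => hl s (List.mem_cons_of_mem _ hs))
    cases hqt : qEOfT M (aggOf M fam) t with
    | none => simpa using ih'
    | some b =>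
      exact le_min ih' (h.tail_uu_le_qEOfT (hl t (by simp)) hqt)

end budgetE

section boundsq
/-! ### The node bounds with an arbitrary tail budget `q` -/

variable {M : ℕ} {G : Multiset (ℕ × ℕ × ℕ)} {fam : List Sh}

/-- packing ratio bound with the level table and a tail budget `q` -/
theorem AboveQ.not_beat_of_Rq (h : AboveQ M G fam) {L : ℕ} (hL : ∀ x ∈ G - famT fam, levTQ x ≤ loLev ∨ levTQ x ≤ L)
    {q : ℕ} (hq : ((G - famT fam).map uu).sum ≤ q)
    (hle : gs fam * K + (tabRQ L).get ((aggOf M fam).kOf M) * q ≤ M * D * K) : ¬ M * D < gsumQ G := by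
  intro hbeat
  have hsplit := h.gsum_split
  have hT : gsumQ (G - famT fam) * K ≤ (tabRQ L).get ((aggOf M fam).kOf M) * q := by
    calc gsumQ (G - famT fam) * K
        = ((G - famT fam).map fun x => gTQ x * K).sum := by unfold gsumQ; rw [Multiset.sum_map_mul_right]
      _ ≤ ((G - famT fam).map fun x => (tabRQ L).get ((aggOf M fam).kOf M) * uu x).sum := by
          apply Multiset.sum_map_le_sum_map
          intro x hx
          have hU := h.univ x (mem_G_of_tail hx)
          exact (gTQ_mul_le_rho hU).trans (Nat.mul_le_mul_right _
            (rhoTQ_le_tabRQ' h.hM hU (hL x hx) (h.tail_capOK hx)))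
      _ = (tabRQ L).get ((aggOf M fam).kOf M) * ((G - famT fam).map uu).sum := by rw [Multiset.sum_map_mul_left]
      _ ≤ (tabRQ L).get ((aggOf M fam).kOf M) * q := Nat.mul_le_mul_left _ hq
  have : gsumQ G * K ≤ M * D * K := by
    rw [hsplit, Nat.add_mul]; exact (Nat.add_le_add_left hT _).trans hle
  have := Nat.le_of_mul_le_mul_right this (show 0 < K by decide)
  omega

/-- first-member bound with a tail budget `q` -/
theorem AboveQ.not_beat_of_first_q (h : AboveQ M G fam) {t : Sh} (ht : t.tr ∈ G - famT fam) (hwt : t = shQ M t.tr)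
    (hL : ∀ x ∈ G - famT fam, levTQ x ≤ loLev ∨ levTQ x ≤ t.lev) {q : ℕ} (hq : ((G - famT fam).map uu).sum ≤ q)
    (hle : gs fam * K + t.g * K + selOf ((aggOf M fam).kOf M) (tabRQ t.lev) *
      min q ((3 * M + (t.a + t.b + t.c)) / 2 - uuA (aggOf M fam) - (t.ab + t.bc + t.ca)) ≤ M * D * K) :
    ¬ M * D < gsumQ G := by
  intro hbeat
  have hle1 : famT (t :: fam) ≤ G := cons_le_of_mem_sub h.le ht
  have hwf1 : WfQ M (t :: fam) := by
    intro s hs; rcases List.mem_cons.mp hs with rfl | hs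
    · exact hwt
    · exact h.wf s hs
  have h1 : AboveQ M G (t :: fam) := ⟨h.hM, h.univ, h.adm, h.admG, h.admE, hwf1, hle1⟩
  have hsplit := h1.gsum_split
  have hgs : gs (t :: fam) = t.g + gs fam := rfl
  have hsub : G - famT (t :: fam) ≤ G - famT fam := sub_cons_le _ _ _
  have hB : ∀ x ∈ G - famT (t :: fam), gTQ x * K ≤ selOf ((aggOf M fam).kOf M) (tabRQ t.lev) * uu x := by
    intro x hx
    have hx' : x ∈ G - famT fam := Multiset.mem_of_le hsub hx
    have hU := h.univ x (mem_G_of_tail hx')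
    rw [selOf_eq]
    exact (gTQ_mul_le_rho hU).trans (Nat.mul_le_mul_right _ (rhoTQ_le_tabRQ' h.hM hU (hL x hx') (h.tail_capOK hx')))
  have hgT : gsumQ (G - famT (t :: fam)) * K ≤
      selOf ((aggOf M fam).kOf M) (tabRQ t.lev) * ((G - famT (t :: fam)).map uu).sum := by
    unfold gsumQ; rw [← Multiset.sum_map_mul_right, ← Multiset.sum_map_mul_left]
    exact Multiset.sum_map_le_sum_map _ _ hB
  have hq1 : ((G - famT (t :: fam)).map uu).sum ≤ q := (sum_map_le_of_le hsub uu).trans hq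
  have hq2 : ((G - famT (t :: fam)).map uu).sum ≤
      (3 * M + (t.a + t.b + t.c)) / 2 - uuA (aggOf M fam) - (t.ab + t.bc + t.ca) := by
    have h2 := two_sum_uu_le h.adm (mem_G_of_tail ht)
    rw [sum_map_split hle1 uu] at h2
    have ef : ((famT (t :: fam)).map uu).sum = uu t.tr + ((famT fam).map uu).sum := by
      rw [famT_cons]; simp
    rw [ef, ← uuA_aggOfQ h.wf] at h2
    have e1 : t.a = t.tr.1 := rfl
    have e2 : t.b = t.tr.2.1 := rfl
    have e3 : t.c = t.tr.2.2 := rfl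
    have e4 : t.ab + t.bc + t.ca = uu t.tr := by
      rw [hwt]; simp [uu]
    have h3 : uu t.tr + uuA (aggOf M fam) + ((G - famT (t :: fam)).map uu).sum ≤
        (3 * M + (t.tr.1 + t.tr.2.1 + t.tr.2.2)) / 2 := by
      rw [Nat.le_div_iff_mul_le (by norm_num)]; omega
    rw [e1, e2, e3, e4]; omega
  have hq' : ((G - famT (t :: fam)).map uu).sum ≤
      min q ((3 * M + (t.a + t.b + t.c)) / 2 - uuA (aggOf M fam) - (t.ab + t.bc + t.ca)) := le_min hq1 hq2
  have : gsumQ G * K ≤ M * D * K := by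
    rw [hsplit, hgs]
    calc (t.g + gs fam + gsumQ (G - famT (t :: fam))) * K
        = gs fam * K + t.g * K + gsumQ (G - famT (t :: fam)) * K := by ring
      _ ≤ gs fam * K + t.g * K + selOf ((aggOf M fam).kOf M) (tabRQ t.lev) *
          min q ((3 * M + (t.a + t.b + t.c)) / 2 - uuA (aggOf M fam) - (t.ab + t.bc + t.ca)) :=
          Nat.add_le_add_left (hgT.trans (Nat.mul_le_mul_left _ hq')) _
      _ ≤ M * D * K := hle
  have := Nat.le_of_mul_le_mul_right this (show 0 < K by decide)
  omega

end boundsq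


end Summit.MatrixMultiplication.MatrixMultiplication.Theorems.ShapeCertVQ
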